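import Summits.Ventures.CertifiedManyBodySolver.Observables.CrutchEnergyDensityLimit
import HarnessLib

/-!
# Pair ODLRO of BCS-crutch ground states in the thermodynamic limit: Griffiths' lemma in the coupling

Cell `hubbard-cq` (venture `CertifiedManyBodySolver`; card `bcs-crutch-odlro-floor`, corollary column — lead
RULING 146 (3), sequel of `CrutchEnergyDensityLimit.lean`). Notation: `A_L(h) = dWaveSourceTorusTT' L t' U μ h`,
`E_L(h) = E₀(A_L(h))`, `e = dWaveSourceEnergyDensityTT' t' U μ`, `Δ_d = pairField dWaveFormFactor L`, crutch
Hamiltonian with base field `H_{g,L}(h₀) = A_L(h₀) − (g/L²)Δ_dᴴΔ_d` (`crutchTorusTT' L t' U μ g` at `h₀ = 0`),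
`pairLRO L ψ = Re⟨ψ, Δ_dᴴΔ_d ψ⟩/L⁴` (the card's D1 ODLRO functional), Moreau functional
`F_g(h) = e(h) + (h − h₀)²/g`, `e_cr(g) = min_h F_g` (the crutch energy density, `exists_tendsto_crutchEnergyDensity`).

FINITE VOLUME (exact, every `L`, all real couplings):
* `ahmTT'_groundEnergy_le_of_groundState` — Hellmann–Feynman chord: a unit ground-state vector `ψ` of
  `H_{g,L}(h₀)` gives `E₀(H_{g',L}) ≤ E₀(H_{g,L}) − (g' − g)·L²·pairLRO L ψ` for every `g'`;
* `pairLRO_le_chord_of_groundState`, `chord_le_pairLRO_of_groundState` — the two Griffiths chords;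
* **`pairLRO_groundState_mono`** — pair ODLRO of ground states is MONOTONE in the crutch coupling:
  `g < g'`, `ψ` a unit ground vector at `g`, `ψ'` one at `g'` ⇒ `pairLRO L ψ ≤ pairLRO L ψ'`.

THERMODYNAMIC LIMIT (unconditional, uniform over the ground space):
* `moreau_minimiser_sq_mono` — minimisers `h₁` of `F_{g₁}`, `h₂` of `F_{g₂}`, `g₁ < g₂` ⇒ `(h₁ − h₀)² ≤ (h₂ − h₀)²`
  (so `g ↦ (h⋆(g) − h₀)²` is monotone for every selection, hence continuous off a countable set);
* **`crutch_pairLRO_eventually_le`** / **`crutch_pairLRO_eventually_ge`** — for `h₀ ≥ 0`, `0 < g₁ < g < g₂`,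
  ANY minimisers `h₁` of `F_{g₁}` and `h₂` of `F_{g₂}`, `δ > 0`: eventually in `L`, EVERY unit ground-state
  vector `ψ` of `H_{g,L}(h₀)` satisfies
  `(h₁ − h₀)²/(g·g₁) − δ ≤ pairLRO L ψ ≤ (h₂ − h₀)²/(g·g₂) + δ`;
* `crutchTorusTT'_pairLRO_mono`, `crutchTorusTT'_pairLRO_eventually_le/ge` — the same on `crutchTorusTT'` by name.

READING (the order-parameter-level thermodynamic-limit theory of the crutch, closing the second half of the
CARDS 17 caveat after the energy level `p494738`): write `Φ(g) = |h⋆(g) − h₀|/g` for the self-consistent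
order parameter (at interior differentiability points the gap equation `h⋆ − h₀ = −(g/2)·∂e(h⋆)`, i.e. `Φ` is
half the sourced response at the self-consistent field). Letting `g₁ ↑ g`, `g₂ ↓ g`: every limit point of the
pair ODLRO density of crutch ground states lies in `[Φ(g−0)², Φ(g+0)²]`, and at every continuity point of the
monotone function `(h⋆(·) − h₀)²` — all but countably many `g` — **`pairLRO L ψ → Φ(g)²` uniformly over the
ground space**: BCS mean-field exactness `ODLRO = |gap/g|²` for the crutch, with `−de_cr/dg = Φ²`
(Hellmann–Feynman in the limit; compare `crutch_susceptibility`: `e(h₀) − e_cr(g) = g·Φ(0+)² + o(g)`).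
Mechanism: variational principle with the ground vector of `H_g` as trial vector for `H_{g'}` (finite `L`);
then the easy approximating-Hamiltonian half at the field `h₁`/`h₂` (finite `L`), `E_L(h)/L² → e(h)`, and the
hard half through `exists_tendsto_crutchEnergyDensity` at `g₁`/`g₂`.

HONEST SCOPE / WHAT THIS IS NOT: statements about the BCS-CRUTCH Hamiltonian (infinite-range mean-field pair
attraction added to the `t–t'` Hubbard torus), not about the Hubbard model; NOTHING at `g = 0`; grand canonical
at one `μ` (no density pinning); `ψ` ranges over ALL unit vectors of the (possibly degenerate) ground space;
no number, no certificate, no phase sentence. Everything PROVED; 0 definitions, 0 named facts, zero compute.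
Instance note: `groundSpace`/`groundEnergy` are elaborated under the default `DecidableEq` instances (as in
the `SourcedTorusTTPrime*` files); consumers living under `Rows/SourcedTorusRows.lean`'s local instance bridge
with `convert … using _`.

References: R. B. Griffiths, J. Math. Phys. 5 (1964) 1215, §2 (Griffiths' lemma: convergence of derivatives
of concave free energies); J.-B. Bru, W. de Siqueira Pedra, Mem. AMS 224 (2013), Thm 2.12 / §2.6 (BCS-type
models: variational formula and order parameters); J.-J. Moreau, Bull. SMF 93 (1965) 273, §7 (proximal
envelope); C. N. Yang, Rev. Mod. Phys. 34 (1962) 694, §4; H. Tasaki, *Physics and Mathematics of Quantum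
Many-Body Systems* (2020), (2.1.6).
-/

noncomputable section

namespace Summit.Ventures.CertifiedManyBodySolver.Observables.SourcedTorusAHM

open Matrix Finset Filter Topology Set Literature.MathematicalPhysics.QuantumLattice
open Literature.Probability.LatticeModels
open scoped ComplexOrder

section FiniteVolume

variable {L : ℕ} [NeZero L]

/-- The approximating (crutch) Hamiltonians at two couplings differ by a multiple of `Δ_dᴴΔ_d`:
`H_{g',L}(h₀) = H_{g,L}(h₀) − ((g' − g)/L²)·Δ_dᴴΔ_d`. -/
theorem ahmTT'_model_eq_model_sub (tp U μ h₀ g g' : ℝ) :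
    dWaveSourceTorusTT' L tp U μ h₀ - ((g' / (L : ℝ) ^ 2 : ℝ) : ℂ) •
        ((pairField dWaveFormFactor L)ᴴ * pairField dWaveFormFactor L) =
      (dWaveSourceTorusTT' L tp U μ h₀ - ((g / (L : ℝ) ^ 2 : ℝ) : ℂ) •
          ((pairField dWaveFormFactor L)ᴴ * pairField dWaveFormFactor L)) -
        (((g' - g) / (L : ℝ) ^ 2 : ℝ) : ℂ) •
          ((pairField dWaveFormFactor L)ᴴ * pairField dWaveFormFactor L) := by
  rw [sub_sub, ← add_smul, ← Complex.ofReal_add]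
  congr 3
  ring

/-- `Re⟨ψ, Δ_dᴴΔ_d ψ⟩ = L⁴ · pairLRO L ψ` (the definition of the per-torus ODLRO functional, cleared of
its denominator). -/
theorem re_pairSq_rayleigh_eq (ψ : Fock (Orb (FermionTorus 2 L))) :
    (star ψ ⬝ᵥ ((pairField dWaveFormFactor L)ᴴ * pairField dWaveFormFactor L) *ᵥ ψ).re =
      (L : ℝ) ^ 4 * pairLRO L ψ := by
  have hL : (L : ℝ) ≠ 0 := Nat.cast_ne_zero.2 (NeZero.ne L)
  unfold pairLRO pairSq
  field_simp

/-- **Hellmann–Feynman / Griffiths chord at finite volume (exact, every `L`, all real `g, g'`).** A unit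
ground-state vector `ψ` of the crutch Hamiltonian `H_{g,L}(h₀) = A_L(h₀) − (g/L²)Δ_dᴴΔ_d` is a trial vector
for `H_{g',L}(h₀) = H_{g,L}(h₀) − ((g' − g)/L²)Δ_dᴴΔ_d`, whence
`E₀(H_{g',L}) ≤ E₀(H_{g,L}) − (g' − g)·L²·pairLRO L ψ`. Griffiths (1964) eq. (12); Tasaki (2020) (2.1.6). -/
theorem ahmTT'_groundEnergy_le_of_groundState (tp U μ h₀ g g' : ℝ)
    {ψ : Fock (Orb (FermionTorus 2 L))} (hψ : star ψ ⬝ᵥ ψ = 1)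
    (hGS : ψ ∈ (dWaveSourceTorusTT' L tp U μ h₀ - ((g / (L : ℝ) ^ 2 : ℝ) : ℂ) •
        ((pairField dWaveFormFactor L)ᴴ * pairField dWaveFormFactor L)).groundSpace) :
    (dWaveSourceTorusTT' L tp U μ h₀ - ((g' / (L : ℝ) ^ 2 : ℝ) : ℂ) •
          ((pairField dWaveFormFactor L)ᴴ * pairField dWaveFormFactor L)).groundEnergy ≤
      (dWaveSourceTorusTT' L tp U μ h₀ - ((g / (L : ℝ) ^ 2 : ℝ) : ℂ) •
            ((pairField dWaveFormFactor L)ᴴ * pairField dWaveFormFactor L)).groundEnergy -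
        (g' - g) * (L : ℝ) ^ 2 * pairLRO L ψ := by
  have hR := groundEnergy_le_rayleigh_holds (ahmTT'_isHermitian_model (L := L) tp U μ h₀ g') ψ hψ
  have hsplit : (dWaveSourceTorusTT' L tp U μ h₀ - ((g' / (L : ℝ) ^ 2 : ℝ) : ℂ) •
        ((pairField dWaveFormFactor L)ᴴ * pairField dWaveFormFactor L)) *ᵥ ψ =
      (dWaveSourceTorusTT' L tp U μ h₀ - ((g / (L : ℝ) ^ 2 : ℝ) : ℂ) •
            ((pairField dWaveFormFactor L)ᴴ * pairField dWaveFormFactor L)) *ᵥ ψ -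
        (((g' - g) / (L : ℝ) ^ 2 : ℝ) : ℂ) •
          (((pairField dWaveFormFactor L)ᴴ * pairField dWaveFormFactor L) *ᵥ ψ) := by
    rw [ahmTT'_model_eq_model_sub tp U μ h₀ g g', sub_mulVec, smul_mulVec]
  rw [hsplit, dotProduct_sub, (mem_groundSpace_iff _ ψ).1 hGS, dotProduct_smul, dotProduct_smul, hψ,
    smul_eq_mul, mul_one, smul_eq_mul, Complex.sub_re, Complex.ofReal_re, Complex.mul_re,
    Complex.ofReal_re, Complex.ofReal_im, zero_mul, sub_zero, re_pairSq_rayleigh_eq] at hR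
  have hL : ((L : ℝ)) ^ 2 ≠ 0 := pow_ne_zero _ (Nat.cast_ne_zero.2 (NeZero.ne L))
  have e1 : (g' - g) / (L : ℝ) ^ 2 * ((L : ℝ) ^ 4 * pairLRO L ψ) =
      (g' - g) * (L : ℝ) ^ 2 * pairLRO L ψ := by
    rw [div_mul_eq_mul_div, div_eq_iff hL]
    ring
  linarith

/-- **Upper chord** (`g < g₂`): `pairLRO L ψ ≤ (E₀(H_{g,L}) − E₀(H_{g₂,L}))/((g₂ − g)·L²)` for every unit
ground-state vector `ψ` of `H_{g,L}(h₀)`. Griffiths (1964). -/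
theorem pairLRO_le_chord_of_groundState (tp U μ h₀ : ℝ) {g g₂ : ℝ} (hg₂ : g < g₂)
    {ψ : Fock (Orb (FermionTorus 2 L))} (hψ : star ψ ⬝ᵥ ψ = 1)
    (hGS : ψ ∈ (dWaveSourceTorusTT' L tp U μ h₀ - ((g / (L : ℝ) ^ 2 : ℝ) : ℂ) •
        ((pairField dWaveFormFactor L)ᴴ * pairField dWaveFormFactor L)).groundSpace) :
    pairLRO L ψ ≤
      ((dWaveSourceTorusTT' L tp U μ h₀ - ((g / (L : ℝ) ^ 2 : ℝ) : ℂ) •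
            ((pairField dWaveFormFactor L)ᴴ * pairField dWaveFormFactor L)).groundEnergy -
          (dWaveSourceTorusTT' L tp U μ h₀ - ((g₂ / (L : ℝ) ^ 2 : ℝ) : ℂ) •
            ((pairField dWaveFormFactor L)ᴴ * pairField dWaveFormFactor L)).groundEnergy) /
        ((g₂ - g) * (L : ℝ) ^ 2) := by
  have hV : (0 : ℝ) < (L : ℝ) ^ 2 := pow_pos (Nat.cast_pos.2 (Nat.pos_of_ne_zero (NeZero.ne L))) 2
  have h := ahmTT'_groundEnergy_le_of_groundState tp U μ h₀ g g₂ hψ hGS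
  rw [le_div_iff₀ (mul_pos (sub_pos.2 hg₂) hV)]
  linarith

/-- **Lower chord** (`g₁ < g`): `(E₀(H_{g₁,L}) − E₀(H_{g,L}))/((g − g₁)·L²) ≤ pairLRO L ψ` for every unit
ground-state vector `ψ` of `H_{g,L}(h₀)`. Griffiths (1964). -/
theorem chord_le_pairLRO_of_groundState (tp U μ h₀ : ℝ) {g₁ g : ℝ} (hg₁ : g₁ < g)
    {ψ : Fock (Orb (FermionTorus 2 L))} (hψ : star ψ ⬝ᵥ ψ = 1)
    (hGS : ψ ∈ (dWaveSourceTorusTT' L tp U μ h₀ - ((g / (L : ℝ) ^ 2 : ℝ) : ℂ) •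
        ((pairField dWaveFormFactor L)ᴴ * pairField dWaveFormFactor L)).groundSpace) :
    ((dWaveSourceTorusTT' L tp U μ h₀ - ((g₁ / (L : ℝ) ^ 2 : ℝ) : ℂ) •
            ((pairField dWaveFormFactor L)ᴴ * pairField dWaveFormFactor L)).groundEnergy -
          (dWaveSourceTorusTT' L tp U μ h₀ - ((g / (L : ℝ) ^ 2 : ℝ) : ℂ) •
            ((pairField dWaveFormFactor L)ᴴ * pairField dWaveFormFactor L)).groundEnergy) /
        ((g - g₁) * (L : ℝ) ^ 2) ≤ pairLRO L ψ := by
  have hV : (0 : ℝ) < (L : ℝ) ^ 2 := pow_pos (Nat.cast_pos.2 (Nat.pos_of_ne_zero (NeZero.ne L))) 2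
  have h := ahmTT'_groundEnergy_le_of_groundState tp U μ h₀ g g₁ hψ hGS
  rw [div_le_iff₀ (mul_pos (sub_pos.2 hg₁) hV)]
  linarith

/-- **Pair ODLRO of crutch ground states is MONOTONE in the crutch coupling (exact, every `L`).** If `ψ`
is a unit ground-state vector of `H_{g,L}(h₀)` and `ψ'` one of `H_{g',L}(h₀)` with `g < g'`, then
`pairLRO L ψ ≤ pairLRO L ψ'` (the two chords through `E₀(H_{g,L})`, `E₀(H_{g',L})`; concavity of the ground
energy in `g`). Griffiths (1964) §2. -/
theorem pairLRO_groundState_mono (tp U μ h₀ : ℝ) {g g' : ℝ} (hgg' : g < g')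
    {ψ ψ' : Fock (Orb (FermionTorus 2 L))} (hψ : star ψ ⬝ᵥ ψ = 1)
    (hGS : ψ ∈ (dWaveSourceTorusTT' L tp U μ h₀ - ((g / (L : ℝ) ^ 2 : ℝ) : ℂ) •
        ((pairField dWaveFormFactor L)ᴴ * pairField dWaveFormFactor L)).groundSpace)
    (hψ' : star ψ' ⬝ᵥ ψ' = 1)
    (hGS' : ψ' ∈ (dWaveSourceTorusTT' L tp U μ h₀ - ((g' / (L : ℝ) ^ 2 : ℝ) : ℂ) •
        ((pairField dWaveFormFactor L)ᴴ * pairField dWaveFormFactor L)).groundSpace) :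
    pairLRO L ψ ≤ pairLRO L ψ' := by
  have hV : (0 : ℝ) < (L : ℝ) ^ 2 := pow_pos (Nat.cast_pos.2 (Nat.pos_of_ne_zero (NeZero.ne L))) 2
  have h1 := ahmTT'_groundEnergy_le_of_groundState tp U μ h₀ g g' hψ hGS
  have h2 := ahmTT'_groundEnergy_le_of_groundState tp U μ h₀ g' g hψ' hGS'
  have h3 : (g' - g) * (L : ℝ) ^ 2 * pairLRO L ψ ≤ (g' - g) * (L : ℝ) ^ 2 * pairLRO L ψ' := by
    linarith
  exact le_of_mul_le_mul_left h3 (mul_pos (sub_pos.2 hgg') hV)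

end FiniteVolume

section ThermodynamicLimit

/-- The value of the Moreau envelope at a coupling is the same for every minimiser: if `h₂` minimises
`h ↦ e(h) + (h − h₀)²/g₂` then the limit `e_cr` of `exists_tendsto_crutchEnergyDensity` at `g₂` equals
`e(h₂) + (h₂ − h₀)²/g₂`. -/
theorem crutchEnergyDensity_eq_of_isMin (tp U μ : ℝ) {h₀ g₂ h₂ e_cr h_opt : ℝ}
    (hopt : e_cr = dWaveSourceEnergyDensityTT' tp U μ h_opt + (h_opt - h₀) ^ 2 / g₂)
    (hle : ∀ h : ℝ, e_cr ≤ dWaveSourceEnergyDensityTT' tp U μ h + (h - h₀) ^ 2 / g₂)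
    (hmin : ∀ h : ℝ, dWaveSourceEnergyDensityTT' tp U μ h₂ + (h₂ - h₀) ^ 2 / g₂ ≤
      dWaveSourceEnergyDensityTT' tp U μ h + (h - h₀) ^ 2 / g₂) :
    e_cr = dWaveSourceEnergyDensityTT' tp U μ h₂ + (h₂ - h₀) ^ 2 / g₂ := by
  refine le_antisymm (hle h₂) ?_
  rw [hopt]
  exact hmin h_opt

/-- **The minimiser distance of the Moreau envelope is monotone in the coupling** (pure real analysis):
if `h₁` minimises `e(h) + (h − h₀)²/g₁` and `h₂` minimises `e(h) + (h − h₀)²/g₂` with `0 < g₁ < g₂`, then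
`(h₁ − h₀)² ≤ (h₂ − h₀)²`. Consequently `g ↦ (h⋆(g) − h₀)²` is monotone for every selection of minimisers,
hence continuous off a countable set — where the two-sided bounds below coincide. Moreau (1965) §7. -/
theorem moreau_minimiser_sq_mono (e : ℝ → ℝ) {h₀ g₁ g₂ h₁ h₂ : ℝ} (hg₁ : 0 < g₁) (hg₁₂ : g₁ < g₂)
    (hmin₁ : ∀ h : ℝ, e h₁ + (h₁ - h₀) ^ 2 / g₁ ≤ e h + (h - h₀) ^ 2 / g₁)
    (hmin₂ : ∀ h : ℝ, e h₂ + (h₂ - h₀) ^ 2 / g₂ ≤ e h + (h - h₀) ^ 2 / g₂) :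
    (h₁ - h₀) ^ 2 ≤ (h₂ - h₀) ^ 2 := by
  have hg₂ : 0 < g₂ := hg₁.trans hg₁₂
  have a := hmin₁ h₂
  have b := hmin₂ h₁
  have hsum : ((h₁ - h₀) ^ 2 - (h₂ - h₀) ^ 2) * (1 / g₁ - 1 / g₂) ≤ 0 := by
    have e1 : ((h₁ - h₀) ^ 2 - (h₂ - h₀) ^ 2) * (1 / g₁ - 1 / g₂) =
        ((h₁ - h₀) ^ 2 / g₁ - (h₂ - h₀) ^ 2 / g₁) + ((h₂ - h₀) ^ 2 / g₂ - (h₁ - h₀) ^ 2 / g₂) := by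
      ring
    rw [e1]
    linarith
  have hpos : 0 < 1 / g₁ - 1 / g₂ := by
    rw [sub_pos]
    exact one_div_lt_one_div_of_lt hg₁ hg₁₂
  nlinarith

/-- **UPPER BOUND on the pair ODLRO of crutch ground states in the thermodynamic limit.** For `h₀ ≥ 0`,
`0 < g < g₂`, ANY minimiser `h₂` of the Moreau functional `h ↦ e(h) + (h − h₀)²/g₂` at the larger coupling,
and `δ > 0`: eventually in `L`, EVERY unit ground-state vector `ψ` of `H_{g,L}(h₀)` has
`pairLRO L ψ ≤ (h₂ − h₀)²/(g·g₂) + δ`. Chain: the upper Griffiths chord, the easy approximating-Hamiltonian half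
at the field `h₂` (finite `L`), `E_L(h₂)/L² → e(h₂)` and the crutch energy-density limit at `g₂`
(`exists_tendsto_crutchEnergyDensity`, the hard half). Griffiths (1964); Bru–de Siqueira Pedra (2013) Thm 2.12. -/
theorem crutch_pairLRO_eventually_le (tp U μ : ℝ) {h₀ g g₂ h₂ δ : ℝ} (hh₀ : 0 ≤ h₀) (hg : 0 < g)
    (hg₂ : g < g₂) (hδ : 0 < δ)
    (hmin₂ : ∀ h : ℝ, dWaveSourceEnergyDensityTT' tp U μ h₂ + (h₂ - h₀) ^ 2 / g₂ ≤
      dWaveSourceEnergyDensityTT' tp U μ h + (h - h₀) ^ 2 / g₂) :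
    ∀ᶠ n : ℕ in atTop, ∀ ψ : Fock (Orb (FermionTorus 2 (n + 1))), star ψ ⬝ᵥ ψ = 1 →
      ψ ∈ (dWaveSourceTorusTT' (n + 1) tp U μ h₀ - ((g / (((n + 1 : ℕ) : ℝ)) ^ 2 : ℝ) : ℂ) •
          ((pairField dWaveFormFactor (n + 1))ᴴ * pairField dWaveFormFactor (n + 1))).groundSpace →
        pairLRO (n + 1) ψ ≤ (h₂ - h₀) ^ 2 / (g * g₂) + δ := by
  have hg₂0 : 0 < g₂ := hg.trans hg₂
  obtain ⟨e₂, hopt, -, -, he₂, hle₂, hT₂⟩ := exists_tendsto_crutchEnergyDensity tp U μ hh₀ hg₂0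
  have he₂' := crutchEnergyDensity_eq_of_isMin tp U μ he₂ hle₂ hmin₂
  obtain ⟨η, hη0, hδη⟩ : ∃ η : ℝ, 0 < η ∧ δ * (g₂ - g) = 2 * η :=
    ⟨δ * (g₂ - g) / 2, by have := sub_pos.2 hg₂; positivity, by ring⟩
  have h1 := Metric.tendsto_nhds.1 hT₂ η hη0
  have h2 := Metric.tendsto_nhds.1 (tendsto_dWaveSourceEnergyDensityTT' tp U μ h₂) η hη0
  filter_upwards [h1, h2] with n hn1 hn2 ψ hψ hGS
  rw [Real.dist_eq, abs_lt] at hn1 hn2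
  have hV0 : (0 : ℝ) < (((n + 1 : ℕ) : ℝ)) ^ 2 := by positivity
  -- the four inputs, cleared of denominators
  have hchord := ahmTT'_groundEnergy_le_of_groundState tp U μ h₀ g g₂ hψ hGS
  have heasy := ahmTT'_groundEnergy_model_le (n + 1) tp U μ h₀ h₂ hg
  have hlow : (dWaveSourceEnergyDensityTT' tp U μ h₂ + (h₂ - h₀) ^ 2 / g₂ - η) * (((n + 1 : ℕ) : ℝ)) ^ 2 ≤
      (dWaveSourceTorusTT' (n + 1) tp U μ h₀ - ((g₂ / (((n + 1 : ℕ) : ℝ)) ^ 2 : ℝ) : ℂ) •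
        ((pairField dWaveFormFactor (n + 1))ᴴ * pairField dWaveFormFactor (n + 1))).groundEnergy := by
    have h' : dWaveSourceEnergyDensityTT' tp U μ h₂ + (h₂ - h₀) ^ 2 / g₂ - η <
        (dWaveSourceTorusTT' (n + 1) tp U μ h₀ - ((g₂ / (((n + 1 : ℕ) : ℝ)) ^ 2 : ℝ) : ℂ) •
          ((pairField dWaveFormFactor (n + 1))ᴴ * pairField dWaveFormFactor (n + 1))).groundEnergy /
          (((n + 1 : ℕ) : ℝ)) ^ 2 := by
      linarith [hn1.1]
    exact ((lt_div_iff₀ hV0).1 h').le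
  have hsrc : (dWaveSourceTorusTT' (n + 1) tp U μ h₂).groundEnergy ≤
      (dWaveSourceEnergyDensityTT' tp U μ h₂ + η) * (((n + 1 : ℕ) : ℝ)) ^ 2 := by
    have h' : (dWaveSourceTorusTT' (n + 1) tp U μ h₂).groundEnergy / (((n + 1 : ℕ) : ℝ)) ^ 2 <
        dWaveSourceEnergyDensityTT' tp U μ h₂ + η := by
      linarith [hn2.2]
    exact ((div_lt_iff₀ hV0).1 h').le
  -- assemble
  have hRHS : ((h₂ - h₀) ^ 2 / (g * g₂) + δ) * ((g₂ - g) * (((n + 1 : ℕ) : ℝ)) ^ 2) =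
      ((h₂ - h₀) ^ 2 / g - (h₂ - h₀) ^ 2 / g₂ + 2 * η) * (((n + 1 : ℕ) : ℝ)) ^ 2 := by
    rw [← hδη]
    field_simp
  have key : pairLRO (n + 1) ψ * ((g₂ - g) * (((n + 1 : ℕ) : ℝ)) ^ 2) ≤
      ((h₂ - h₀) ^ 2 / (g * g₂) + δ) * ((g₂ - g) * (((n + 1 : ℕ) : ℝ)) ^ 2) := by
    rw [hRHS]
    have hpen : (h₂ - h₀) ^ 2 * (((n + 1 : ℕ) : ℝ)) ^ 2 / g =
        (h₂ - h₀) ^ 2 / g * (((n + 1 : ℕ) : ℝ)) ^ 2 := by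
      ring
    rw [hpen] at heasy
    linarith [hlow, hsrc, hchord, heasy]
  exact le_of_mul_le_mul_right key (mul_pos (sub_pos.2 hg₂) hV0)

/-- **LOWER BOUND on the pair ODLRO of crutch ground states in the thermodynamic limit.** For `h₀ ≥ 0`,
`0 < g₁ < g`, ANY minimiser `h₁` of `h ↦ e(h) + (h − h₀)²/g₁` at the smaller coupling, and `δ > 0`:
eventually in `L`, EVERY unit ground-state vector `ψ` of `H_{g,L}(h₀)` has
`(h₁ − h₀)²/(g·g₁) − δ ≤ pairLRO L ψ`. Chain: the lower Griffiths chord, the easy half at the field `h₁`,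
`E_L(h₁)/L² → e(h₁)`, the crutch energy-density limit at `g₁`. Griffiths (1964); Bru–de Siqueira Pedra
(2013) Thm 2.12. -/
theorem crutch_pairLRO_eventually_ge (tp U μ : ℝ) {h₀ g₁ g h₁ δ : ℝ} (hh₀ : 0 ≤ h₀) (hg₁ : 0 < g₁)
    (hg : g₁ < g) (hδ : 0 < δ)
    (hmin₁ : ∀ h : ℝ, dWaveSourceEnergyDensityTT' tp U μ h₁ + (h₁ - h₀) ^ 2 / g₁ ≤
      dWaveSourceEnergyDensityTT' tp U μ h + (h - h₀) ^ 2 / g₁) :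
    ∀ᶠ n : ℕ in atTop, ∀ ψ : Fock (Orb (FermionTorus 2 (n + 1))), star ψ ⬝ᵥ ψ = 1 →
      ψ ∈ (dWaveSourceTorusTT' (n + 1) tp U μ h₀ - ((g / (((n + 1 : ℕ) : ℝ)) ^ 2 : ℝ) : ℂ) •
          ((pairField dWaveFormFactor (n + 1))ᴴ * pairField dWaveFormFactor (n + 1))).groundSpace →
        (h₁ - h₀) ^ 2 / (g * g₁) - δ ≤ pairLRO (n + 1) ψ := by
  have hg0 : 0 < g := hg₁.trans hg
  obtain ⟨e₁, hopt, -, -, he₁, hle₁, hT₁⟩ := exists_tendsto_crutchEnergyDensity tp U μ hh₀ hg₁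
  have he₁' := crutchEnergyDensity_eq_of_isMin tp U μ he₁ hle₁ hmin₁
  obtain ⟨η, hη0, hδη⟩ : ∃ η : ℝ, 0 < η ∧ δ * (g - g₁) = 2 * η :=
    ⟨δ * (g - g₁) / 2, by have := sub_pos.2 hg; positivity, by ring⟩
  have h1 := Metric.tendsto_nhds.1 hT₁ η hη0
  have h2 := Metric.tendsto_nhds.1 (tendsto_dWaveSourceEnergyDensityTT' tp U μ h₁) η hη0
  filter_upwards [h1, h2] with n hn1 hn2 ψ hψ hGS
  rw [Real.dist_eq, abs_lt] at hn1 hn2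
  have hV0 : (0 : ℝ) < (((n + 1 : ℕ) : ℝ)) ^ 2 := by positivity
  have hchord := ahmTT'_groundEnergy_le_of_groundState tp U μ h₀ g g₁ hψ hGS
  have heasy := ahmTT'_groundEnergy_model_le (n + 1) tp U μ h₀ h₁ hg0
  have hlow : (dWaveSourceEnergyDensityTT' tp U μ h₁ + (h₁ - h₀) ^ 2 / g₁ - η) * (((n + 1 : ℕ) : ℝ)) ^ 2 ≤
      (dWaveSourceTorusTT' (n + 1) tp U μ h₀ - ((g₁ / (((n + 1 : ℕ) : ℝ)) ^ 2 : ℝ) : ℂ) •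
        ((pairField dWaveFormFactor (n + 1))ᴴ * pairField dWaveFormFactor (n + 1))).groundEnergy := by
    have h' : dWaveSourceEnergyDensityTT' tp U μ h₁ + (h₁ - h₀) ^ 2 / g₁ - η <
        (dWaveSourceTorusTT' (n + 1) tp U μ h₀ - ((g₁ / (((n + 1 : ℕ) : ℝ)) ^ 2 : ℝ) : ℂ) •
          ((pairField dWaveFormFactor (n + 1))ᴴ * pairField dWaveFormFactor (n + 1))).groundEnergy /
          (((n + 1 : ℕ) : ℝ)) ^ 2 := by
      linarith [hn1.1]
    exact ((lt_div_iff₀ hV0).1 h').le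
  have hsrc : (dWaveSourceTorusTT' (n + 1) tp U μ h₁).groundEnergy ≤
      (dWaveSourceEnergyDensityTT' tp U μ h₁ + η) * (((n + 1 : ℕ) : ℝ)) ^ 2 := by
    have h' : (dWaveSourceTorusTT' (n + 1) tp U μ h₁).groundEnergy / (((n + 1 : ℕ) : ℝ)) ^ 2 <
        dWaveSourceEnergyDensityTT' tp U μ h₁ + η := by
      linarith [hn2.2]
    exact ((div_lt_iff₀ hV0).1 h').le
  have hLHS : ((h₁ - h₀) ^ 2 / (g * g₁) - δ) * ((g - g₁) * (((n + 1 : ℕ) : ℝ)) ^ 2) =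
      ((h₁ - h₀) ^ 2 / g₁ - (h₁ - h₀) ^ 2 / g - 2 * η) * (((n + 1 : ℕ) : ℝ)) ^ 2 := by
    rw [← hδη]
    field_simp
  have key : ((h₁ - h₀) ^ 2 / (g * g₁) - δ) * ((g - g₁) * (((n + 1 : ℕ) : ℝ)) ^ 2) ≤
      pairLRO (n + 1) ψ * ((g - g₁) * (((n + 1 : ℕ) : ℝ)) ^ 2) := by
    rw [hLHS]
    have hpen : (h₁ - h₀) ^ 2 * (((n + 1 : ℕ) : ℝ)) ^ 2 / g =
        (h₁ - h₀) ^ 2 / g * (((n + 1 : ℕ) : ℝ)) ^ 2 := by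
      ring
    rw [hpen] at heasy
    linarith [hlow, hsrc, hchord, heasy]
  exact le_of_mul_le_mul_right key (mul_pos (sub_pos.2 hg) hV0)

end ThermodynamicLimit

section ByName

/-! ## The same on the card's D1 object `crutchTorusTT'` (`h₀ = 0`) by name -/

variable {L : ℕ} [NeZero L]

/-- **Monotonicity by name**: unit ground-state vectors `ψ` of `crutchTorusTT' L t' U μ g` and `ψ'` of
`crutchTorusTT' L t' U μ g'`, `g < g'`, have `pairLRO L ψ ≤ pairLRO L ψ'` (every `L`). -/
theorem crutchTorusTT'_pairLRO_mono (tp U μ : ℝ) {g g' : ℝ} (hgg' : g < g')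
    {ψ ψ' : Fock (Orb (FermionTorus 2 L))} (hψ : star ψ ⬝ᵥ ψ = 1)
    (hGS : ψ ∈ (crutchTorusTT' L tp U μ g).groundSpace) (hψ' : star ψ' ⬝ᵥ ψ' = 1)
    (hGS' : ψ' ∈ (crutchTorusTT' L tp U μ g').groundSpace) :
    pairLRO L ψ ≤ pairLRO L ψ' := by
  rw [crutchTorusTT'_eq_model] at hGS hGS'
  have h := pairLRO_groundState_mono tp U μ 0 hgg' hψ (by simpa using hGS) hψ' (by simpa using hGS')
  exact h

/-- **TL upper bound by name** (`h₀ = 0`): for `0 < g < g₂`, any minimiser `h₂` of `e(h) + h²/g₂` and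
`δ > 0`, eventually every unit ground-state vector of `crutchTorusTT' L t' U μ g` has
`pairLRO L ψ ≤ h₂²/(g·g₂) + δ`. -/
theorem crutchTorusTT'_pairLRO_eventually_le (tp U μ : ℝ) {g g₂ h₂ δ : ℝ} (hg : 0 < g) (hg₂ : g < g₂)
    (hδ : 0 < δ)
    (hmin₂ : ∀ h : ℝ, dWaveSourceEnergyDensityTT' tp U μ h₂ + h₂ ^ 2 / g₂ ≤
      dWaveSourceEnergyDensityTT' tp U μ h + h ^ 2 / g₂) :
    ∀ᶠ n : ℕ in atTop, ∀ ψ : Fock (Orb (FermionTorus 2 (n + 1))), star ψ ⬝ᵥ ψ = 1 →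
      ψ ∈ (crutchTorusTT' (n + 1) tp U μ g).groundSpace → pairLRO (n + 1) ψ ≤ h₂ ^ 2 / (g * g₂) + δ := by
  have h := crutch_pairLRO_eventually_le tp U μ (h₀ := 0) (h₂ := h₂) le_rfl hg hg₂ hδ
    (fun h => by simpa using hmin₂ h)
  filter_upwards [h] with n hn ψ hψ hGS
  rw [crutchTorusTT'_eq_model] at hGS
  simpa using hn ψ hψ (by simpa using hGS)

/-- **TL lower bound by name** (`h₀ = 0`): for `0 < g₁ < g`, any minimiser `h₁` of `e(h) + h²/g₁` and
`δ > 0`, eventually every unit ground-state vector of `crutchTorusTT' L t' U μ g` has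
`h₁²/(g·g₁) − δ ≤ pairLRO L ψ`. -/
theorem crutchTorusTT'_pairLRO_eventually_ge (tp U μ : ℝ) {g₁ g h₁ δ : ℝ} (hg₁ : 0 < g₁) (hg : g₁ < g)
    (hδ : 0 < δ)
    (hmin₁ : ∀ h : ℝ, dWaveSourceEnergyDensityTT' tp U μ h₁ + h₁ ^ 2 / g₁ ≤
      dWaveSourceEnergyDensityTT' tp U μ h + h ^ 2 / g₁) :
    ∀ᶠ n : ℕ in atTop, ∀ ψ : Fock (Orb (FermionTorus 2 (n + 1))), star ψ ⬝ᵥ ψ = 1 →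
      ψ ∈ (crutchTorusTT' (n + 1) tp U μ g).groundSpace → h₁ ^ 2 / (g * g₁) - δ ≤ pairLRO (n + 1) ψ := by
  have h := crutch_pairLRO_eventually_ge tp U μ (h₀ := 0) (h₁ := h₁) le_rfl hg₁ hg hδ
    (fun h => by simpa using hmin₁ h)
  filter_upwards [h] with n hn ψ hψ hGS
  rw [crutchTorusTT'_eq_model] at hGS
  simpa using hn ψ hψ (by simpa using hGS)

end ByName

end Summit.Ventures.CertifiedManyBodySolver.Observables.SourcedTorusAHM

end
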